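import Literature.Probability.RandomPlanarGeometry.HexSAWTheorem1
import Literature.Probability.RandomPlanarGeometry.SAWRatioLimit
import HarnessLib

/-!
# Kesten's two-step ratio limit on the hexagonal lattice: the engine
# `c_{N+2}(ℍ)/c_N(ℍ) → 2 + √2` from (K3-ℍ) `c_N ≤ c_{N+4}` and the two-step Kesten inequality

Topic `Literature/Probability/RandomPlanarGeometry`. Sources: N. Madras, G. Slade, *The Self-Avoiding Walk* (1993),
§7.3, Lemma 7.3.1 and Theorem 7.3.4 (a) (`c_{N+2}/c_N → μ²` on `ℤ^d`; H. Kesten, J. Math. Phys. 4 (1963));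
H. Duminil-Copin, S. Smirnov, Ann. of Math. 175 (2012), Theorem 1 (`μ_ℍ = √(2+√2)`, tree theorem
`DuminilCopinSmirnov2012_thm1_holds`). Lane «pcv-sawmu» bet A2 «HEX-RATIO-2» (lead g8 r58; faces a-idea-1
`Doors_Day3.lean` §C1: `HexRatioTwo`, `HexPlusFour`, `HexRatioLower`), block ENGINE-ℍ:

* `hexRatioLower_of_plusFour` — (K3-ℍ) `c_N ≤ c_{N+4}` gives hypothesis (ii) of Lemma 7.3.1, `c_{N+2}/c_N ≥ 1/c_2`;
* `kestenIneqTwo_of_parity` — the two-step Kesten inequality (7.3.4) along EACH parity class (which is what the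
  abstract assembly `kesten_ineq_of_transfer` delivers when fed the walks of length `2n + δ`) merges into the
  inequality for all `N`;
* **`hexRatioTwo_of`** — (K3-ℍ) + the two-step inequality ⇒ `c_{N+2}(ℍ)/c_N(ℍ) → 2 + √2`, by the tree's abstract
  Lemma 7.3.1 `Zd.tendsto_ratio_of_kesten` with `a_n = c_n(ℍ)`, `μ = √(2+√2)` (DCS Theorem 1).
-/

noncomputable section

open Filter Topology

namespace Literature.Probability.RandomPlanarGeometry.SAW

/-- (K3-ℍ) ⇒ hypothesis (ii) of Madras–Slade Lemma 7.3.1 for `a_N = c_N(ℍ)`: `c_{N+2}/c_N ≥ 1/c_2`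
(`c_N ≤ c_{N+4} ≤ c_{N+2} c_2`). [cite: MadrasSlade1993, Lemma 7.3.1 (hypothesis (ii)) and (1.2.3)] -/
theorem hexRatioLower_of_plusFour (h : ∀ N : ℕ, hexSawCount N ≤ hexSawCount (N + 4)) :
    ∃ c : ℝ, 0 < c ∧ ∀ N : ℕ, c ≤ (hexSawCount (N + 2) : ℝ) / hexSawCount N := by
  refine ⟨1 / hexSawCount 2, by have := hexSawCount_pos 2; positivity, fun N => ?_⟩
  have h0 : (0 : ℝ) < hexSawCount N := by exact_mod_cast hexSawCount_pos N
  have hc2 : (0 : ℝ) < hexSawCount 2 := by exact_mod_cast hexSawCount_pos 2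
  have h4 : (hexSawCount N : ℝ) ≤ hexSawCount (N + 2) * hexSawCount 2 := by
    have a := h N
    have b := hexSawCount_add_le (N + 2) 2
    exact_mod_cast a.trans b
  rw [one_div, inv_le_iff_one_le_mul₀ hc2, div_mul_eq_mul_div, le_div_iff₀ h0, one_mul]
  exact h4

/-- **Parity merge**: a Kesten inequality `φ_M² − D/m ≤ φ_M φ_{M+2}`, `M = 2m + δ`, eventually in `m` for each
parity `δ ∈ {0, 1}`, gives `φ_N² − D'/N ≤ φ_N φ_{N+2}` eventually in `N`. [cite: MadrasSlade1993, Theorem 7.3.2 (7.3.4)] -/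
theorem kestenIneqTwo_of_parity {φ : ℕ → ℝ}
    (h : ∀ δ : ℕ, δ ≤ 1 → ∃ D : ℝ, ∀ᶠ m : ℕ in atTop,
      φ (2 * m + δ) ^ 2 - D / m ≤ φ (2 * m + δ) * φ (2 * m + δ + 2)) :
    ∃ D : ℝ, ∀ᶠ N : ℕ in atTop, φ N ^ 2 - D / N ≤ φ N * φ (N + 2) := by
  obtain ⟨D₀, h₀⟩ := h 0 (by norm_num)
  obtain ⟨D₁, h₁⟩ := h 1 (by norm_num)
  obtain ⟨m₀, hm₀⟩ := eventually_atTop.1 h₀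
  obtain ⟨m₁, hm₁⟩ := eventually_atTop.1 h₁
  set D : ℝ := 3 * max (max D₀ D₁) 0 with hD
  have hDge : ∀ D' ∈ [D₀, D₁], D' ≤ max (max D₀ D₁) 0 := by
    intro D' hD'
    simp only [List.mem_cons, List.not_mem_nil, or_false] at hD'
    rcases hD' with rfl | rfl
    · exact (le_max_left _ _).trans (le_max_left _ _)
    · exact (le_max_right _ _).trans (le_max_left _ _)
  have hM0 : 0 ≤ max (max D₀ D₁) 0 := le_max_right _ _
  refine ⟨D, eventually_atTop.2 ⟨2 * max m₀ m₁ + 3, fun N hN => ?_⟩⟩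
  -- write `N = 2m + δ`
  obtain ⟨m, δ, hδ, rfl⟩ : ∃ m δ : ℕ, δ ≤ 1 ∧ N = 2 * m + δ :=
    ⟨N / 2, N % 2, by omega, by omega⟩
  have hm : max m₀ m₁ + 1 ≤ m := by omega
  have hmpos : (0 : ℝ) < m := by exact_mod_cast (show 0 < m by omega)
  have hNpos : (0 : ℝ) < ((2 * m + δ : ℕ) : ℝ) := by exact_mod_cast (show 0 < 2 * m + δ by omega)
  -- the parity-class inequality at `m`, with `D_δ/m ≤ D/N`
  have key : ∀ {D' : ℝ}, D' ≤ max (max D₀ D₁) 0 →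
      φ (2 * m + δ) ^ 2 - D' / m ≤ φ (2 * m + δ) * φ (2 * m + δ + 2) →
      φ (2 * m + δ) ^ 2 - D / ((2 * m + δ : ℕ) : ℝ) ≤ φ (2 * m + δ) * φ (2 * m + δ + 2) := by
    intro D' hD' hineq
    have hcmp : D' / m ≤ D / ((2 * m + δ : ℕ) : ℝ) := by
      rw [div_le_div_iff₀ hmpos hNpos, hD]
      push_cast
      have hδ1 : (δ : ℝ) ≤ 1 := by exact_mod_cast hδ
      have hm1 : (1 : ℝ) ≤ m := by exact_mod_cast (show 1 ≤ m by omega)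
      nlinarith [mul_le_mul_of_nonneg_right hD' hmpos.le]
    linarith
  interval_cases δ
  · exact key (hDge D₀ (by simp)) (hm₀ m (by omega))
  · exact key (hDge D₁ (by simp)) (hm₁ m (by omega))

/-- **ENGINE-ℍ: `c_{N+2}(ℍ)/c_N(ℍ) → 2 + √2`** from (K3-ℍ) `c_N ≤ c_{N+4}` and the two-step Kesten inequality
(7.3.4) on `ℍ` — Madras–Slade Lemma 7.3.1 (tree `Zd.tendsto_ratio_of_kesten`) with `a_N = c_N(ℍ)` and
`μ = √(2+√2)` (Duminil-Copin–Smirnov). [cite: MadrasSlade1993, Lemma 7.3.1 and Theorem 7.3.4 (a); DuminilCopinSmirnov2012, Theorem 1] -/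
theorem hexRatioTwo_of (h3 : ∀ N : ℕ, hexSawCount N ≤ hexSawCount (N + 4))
    (hK : ∃ D : ℝ, ∀ᶠ N : ℕ in atTop,
      ((hexSawCount (N + 2) : ℝ) / hexSawCount N) ^ 2 - D / N ≤
        ((hexSawCount (N + 2) : ℝ) / hexSawCount N) * ((hexSawCount (N + 4) : ℝ) / hexSawCount (N + 2))) :
    Tendsto (fun N : ℕ => (hexSawCount (N + 2) : ℝ) / hexSawCount N) atTop (𝓝 (2 + Real.sqrt 2)) := by
  have hμ : (0 : ℝ) < Real.sqrt (2 + Real.sqrt 2) := by positivity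
  obtain ⟨c, hc, hcN⟩ := hexRatioLower_of_plusFour h3
  have h := Zd.tendsto_ratio_of_kesten (a := fun n => (hexSawCount n : ℝ)) hμ
    (fun n => by exact_mod_cast hexSawCount_pos n) DuminilCopinSmirnov2012_thm1_holds
    ⟨c, hc, Eventually.of_forall hcN⟩ hK
  have hsq : Real.sqrt (2 + Real.sqrt 2) ^ 2 = 2 + Real.sqrt 2 := Real.sq_sqrt (by positivity)
  rw [hsq] at h
  exact h

/-- ENGINE-ℍ with the Kesten inequality supplied PER PARITY CLASS (the form produced by
`kesten_ineq_of_transfer` on the walks of length `2m + δ`). [cite: MadrasSlade1993, Lemma 7.3.1 and Theorem 7.3.4 (a)] -/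
theorem hexRatioTwo_of_parity (h3 : ∀ N : ℕ, hexSawCount N ≤ hexSawCount (N + 4))
    (hK : ∀ δ : ℕ, δ ≤ 1 → ∃ D : ℝ, ∀ᶠ m : ℕ in atTop,
      ((hexSawCount (2 * m + δ + 2) : ℝ) / hexSawCount (2 * m + δ)) ^ 2 - D / m ≤
        ((hexSawCount (2 * m + δ + 2) : ℝ) / hexSawCount (2 * m + δ)) *
          ((hexSawCount (2 * m + δ + 2 + 2) : ℝ) / hexSawCount (2 * m + δ + 2))) :
    Tendsto (fun N : ℕ => (hexSawCount (N + 2) : ℝ) / hexSawCount N) atTop (𝓝 (2 + Real.sqrt 2)) :=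
  hexRatioTwo_of h3 (kestenIneqTwo_of_parity (φ := fun N => (hexSawCount (N + 2) : ℝ) / hexSawCount N) hK)

end Literature.Probability.RandomPlanarGeometry.SAW

end
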